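import Summits.BirchSwinnertonDyer.BirchSwinnertonDyer.Theorems.UniversalToricDescentDefectTransportModThreePTOfSigmaCongruence
import Summits.BirchSwinnertonDyer.BirchSwinnertonDyer.Theorems.UniversalToricDescentSigmaCongruenceAtThreeIffInvariantPair
import Summits.BirchSwinnertonDyer.BirchSwinnertonDyer.Theorems.UniversalToricDescentAcDualMuZeroCriterion
import Literature.NumberTheory.EllipticCurves.UnrIntegersSqrtNegOne
import HarnessLib

/-!
# NODE `weight-jet-binomial` on crux A = `SigmaCongruenceAtThree` (stmt-BirchSwinnertonDyer-27120, route UTD, rank 201)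

Crux-ideate STANDING COVER, generation 7 (seat `cruxidea-stmt-BirchSwinnertonDyer-27120-1-g7`, 2026-08-30).  Output of the
generation = this COMPILING workfile (0 `sorry`, no new axioms, no banned option) + card `Ideas/weight-jet-binomial.md`
+ memo `NodeWeightJetBinomial.md`.  Technique (differentiated from the pool): **PERIOD-GAUGE RIGIDITY + the VERTICAL
(weight-direction) jet of the Σ-depleted frames**; lens = strengthen + transfer (Katz / BDP square-root road).

## 0. What this generation adds, in one paragraph

Crux A asks `X ≡ u·Y (mod 𝔪_{R₀})` coefficientwise for SOME unit `u ∈ R₀⟦T⟧^×` (X, Y the Σ-depleted BDP frames of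
the wild curve `E` and its tame `3`-congruent twin `E′`); modulo print this is `λ(X) = λ(Y)` (INVARIANT-PAIR
certificate p705895): A constrains the ORDER of `X̄/Ȳ ∈ F̄₃((T))` and nothing else.  Every pool road either reads
VALUES at horizontal (finite-order, deep `3`-power conductor) characters (one-deep-layer, gauss-extraction,
deep-conductor-stability; heegner-log-anchor = the value at `T = 0`), or POSITS a global structure
(sqrt-toric-functional's additive `Θ` on `ℤ^ℕ`, universal-period-pair, lambda-scale-blind).  This node types the
statement the Katz/BDP road actually PROVES when followed to the end: the ratio `X̄/Ȳ` is not an arbitrary unit —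
it lies in the TWO-PARAMETER PERIOD GAUGE `Ḡ = F̄₃^× · (1+T)^{ℤ₃}` (piece J⁼ `GaugeCongruenceAtThree`, §3; strictly
stronger in SHAPE than A, §2), isolates the two ELEMENTARY rigidity lemmas that upgrade "some unit" to "gauge"
(GR `GaugeRigidityAtThree`, typed §4; EF, §2 of this docstring), and supplies the Mahler dictionary
(`alternating_moment_symm`, §5) that turns the gauge statement into an INSTRUMENT reading `λ` — and testing J⁼ digit
by digit — from interpolation-range CENTRAL `L`-values, the direction every predecessor declared `λ`-blind
("`|T_m| ≤ 1/3` ⟹ values blind mod 3": true value-wise, false jet-wise: the `K`-jet mod `3` is an explicit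
`ℤ₃`-linear functional of the first `O(K)` values known to `3`-adic precision `O(K log K)` — Mahler coefficients
`α_j` (Kummer bound `‖α_j‖ ≤ ‖u₀−1‖^j`, `alternating_moment_symm`) → weight-TAYLOR coefficients `τ_n` at the trivial
character (Stirling change of basis, convergent by the Kummer bound) → `c_k`, the Taylor system being TRIANGULAR:
`n!·τ_n/(log u₀)^n = Σ_{k≤n} k!·S(n,k)·c_k`, `S` = Stirling numbers of the second kind).

## 1. Pieces and tags (D-0171)

* `gauge w s = C w · (1+T)^s` (§1, generic `p`; PROVED: `isUnit_gauge`, group law `gauge_mul_gauge`,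
  `gauge_one_zero`, `gauge_mul_gauge_inv`, coefficients `constantCoeff_gauge`, `coeff_one_gauge`).
* `UnitClass` (A's conclusion shape) vs `GaugeClass` (the node's) (§2, PROVED): `unitClass_of_gaugeClass`, and the
  STRICTNESS witness `exists_unitClass_not_gaugeClass` (`X = 1 + √−1·T`, `Y = 1`; tree facts
  `exists_sq_eq_neg_one_mem_unrIntegers_three`, `norm_coe_toUnr`) — `GaugeClass` is NOT a costume of `UnitClass`:
  the coset space `(1 + T·F̄₃⟦T⟧)/Ḡ·F̄₃^×` is infinite-dimensional and the witness is its first non-trivial coset.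
* **J⁼ `GaugeCongruenceAtThree`** (§3) — CRUX-SIDE piece — A's binders VERBATIM, A's conclusion with `u` restricted
  to `G` (and A's `∃ e` KEPT, see EF) — tag **STRONGER than A** (`sigmaCongruenceAtThree_of_gaugeCongruence`,
  kernel-checked BY NAME, `hB`-free, print-free) and **⟹ PARENT ♭T≤** (`defectTransportModThreePT_of_gaugeCongruence`
  via B″ p698423) — **UNDECIDED**.  The converse A ⟹ J⁼ is NOT derivable: J⁼ predicts every digit of `X̄/Ȳ`, A only
  its `T`-order.
* **GR `GaugeRigidityAtThree`** (§4) — support leaf, typed — tag **WEAKER** (pure `3`-adic analysis, no curve) —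
  **ATTACKABLE now** (proof sketch §3 below; M–L).
* `alternating_moment_symm` (§5) — support, PROVED (any commutative ring): the symmetric mixed-moment identity behind
  the Kummer bound `‖Δ^m‖ ≤ ‖u₀ − 1‖^m` of the instrument.
* Leaves NOT typed here — they need the CM-point / Serre–Tate `t`-expansion vocabulary the tree lacks (the SAME typing
  gap as sqrt-toric-functional's F1/F2 and gauss-extraction's ST; no new interface is posited): KJ_E (ATTACKABLE as
  a PORT, the research leaf), KJ_E′ / DEPL / MU′ (print), JC (print METHOD), EF (elementary, ATTACKABLE; typable over
  `localPolynomialAt` once complex-conjugate places are paired — left to g8).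

## 2. The derivation J⁼ ⟸ KJ_E ∧ KJ_E′ ∧ JC ∧ MU′ ∧ DEPL ∧ GR ∧ EF (informal; series in `R₀⟦T⟧`, bars = mod `𝔪`)

`ℒ(F) ∈ R₀⟦T⟧` := the BDP/Castella–Hsieh SQUARE-ROOT series of a `U₃`-null integral `3`-adic modular form `F` of tame
level `L₀`: `Σ_{[𝔞]∈Pic O_K}` (𝔞-twisted) Amice transform of the CM `t`-expansion measure of `θ⁻¹F` at the
conductor-ONE Heegner point `x_𝔞` (ordinary, `3` splits) [BDP13 §5.2 + Thm 5.13; CH18 §3.3].  The wild newform `f_E`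
(`27 ∣ N`, `U₃ f_E = 0`, so `f_E^♭ = f_E`) IS such an `F`: restrict to the ordinary locus with its `Γ₀(27)`-structure =
canonical subgroup of order `27` (Katz; Kriz–Li's standing move "any reduction type at `p`") — NO trace to lower
`3`-level is taken (the step that killed rankin-selberg-linearity-transplant); `g_E := f_E^{[T3]}`, `g_E′ :=
f_E′^{[T3]}` the `3·∏_{ℓ∈T}ℓ`-depletions, both of one common tame level.
* (KJ_E′, print) a period pair with `c′·ℒ(f_E′)²` a BDP frame (`IsBDPLFunction`), `c′ ∈ R₀`: [BDP13 Thm 5.13]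
  (`3 ∤ N′`), [CH18 Thm 4.9] shape.
* (KJ_E, PORT — ATTACKABLE, the research leaf) the same for `f_E`: BDP's proof verbatim (explicit Waldspurger
  [BDP13 Thm 4.6]: the level enters only through the Heegner hypothesis, which `27 ∣ N` meets as `3` splits; Katz
  `δ^j ↔ θ^j` at ordinary CM points), plus ONE local computation: the toric integral at the split wild place of the
  NEW vector of the supercuspidal `π₃` against the UNRAMIFIED torus characters of the interpolation range is a
  non-zero CONSTANT (Kirillov model: the new vector of a supercuspidal is `1_{O^×}`; [CST14 Prop 3.12]) — matching
  `bdpInterpolationValue`'s `3`-factor `(1 − a₃… + ε₃…)² = 1` (`a₃ = ε₃ = 0`).  No stable-`ε` / deep-conductor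
  analysis (contrast HL1_E of one-deep-layer / gauss-extraction: Waldspurger at RAMIFIED `χ` of conductor `3ⁿ`).
* (JC, print METHOD) `ℒ̄(F)` depends only on `F̄`: `ℒ` is `R₀`-linear in the `t`-expansions `F(x_𝔞)(t) ∈ R₀⟦t−1⟧`, and
  `ḡ_E = ḡ_E′` (`ModPCongruent` + depletion = sqrt-toric's `stub_heckeCongruence`, M) ⟹ `t`-expansions agree mod `3`
  (`q`-expansion principle on the irreducible Igusa tower) ⟹ `ℒ(g_E) ≡ ℒ(g_E′) (mod 3R₀⟦T⟧)` AS SERIES.  In print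
  for (cusp, Eisenstein) pairs: Kriz 2016 Main Thm [corpus:paper-arxiv-1512.05032 p.8 Thm 3, p.13 L1-3: "we use the
  corresponding congruence between the twisted traces"], for cusp pairs value-wise Kriz–Li 2019 §3 (tree fact, the
  `k = 0` row).  WEIGHT-JET reading: `[T^k]ℒ(F) = Σ_𝔞 (B_{k,𝔞}·θ⁻¹F)(x_𝔞)`, `B_{k,𝔞}` = twist by the CONTINUOUS
  `ℤ₃`-valued function `n ↦ binom(log⟨n·N𝔞⟩/log u₀, k)` on `ℤ₃^×` (Katz–Gouvêa twisting of `U₃`-null forms): every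
  Taylor coefficient at the trivial character is a CM VALUE of an integral form, so the VALUE engine transports each
  `k` — no `t`-expansion injectivity is used, only integrality.
* (MU′, print) `μ(ℒ(g_E′)) = 0`: Hsieh14 Thm B for the TAME twin (`3 ∤ N′`) + `μ(∏P̄′) = 0` (tree
  `hasUnitContent_aeval_localPolynomialAt`).  By JC then `μ(ℒ(g_E)) = 0` — the wild `μ = 0` is OUTPUT, not the input
  `hB`/27933 of g3–g5 (KJ_E's constant `c` being a unit is part of KJ_E).
* (DEPL, print) `ℒ(F|V_ℓ) = c_ℓ (1+T)^{e_𝔩} ℒ(F)`, `e_𝔩 := κ(Frob_𝔩) ∈ 3^{c_𝔩}ℤ₃^×` the TRUE Frobenius exponent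
  (values: CM point translated by `𝔩`; series: identity principle on the interpolation range), whence
  `ℒ(F^{[ℓ]}) = P_𝔩(q_ℓ⁻¹(1+T)^{e_𝔩})·ℒ(F)` — ONE place per `ℓ` [BDP13 §5.2; = g5 HL1(ii)].
* (FRAMES, tree + GR) `UniversalToricDescentTwinSplit.span_singleton_eq_of_isBDPLFunction`: a binder frame is
  `L = V_E·c·ℒ(f_E)²` with `V_E ∈ R₀⟦T⟧^×` INTERPOLATING the geometric sequence of period ratios
  `((Ω′_pΩ_K)/(Ω_pΩ′_K))^{4m}` on the interpolation progression; by GR, `V_E ∈ G`.  Same for `L′`.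
* (EF, elementary — ATTACKABLE) at the TRUE exponents (`e_𝔩̄ = −e_𝔩`, `v₃ = c_v`: admissible for A's / J⁼'s
  `∃ e`), for every `ℓ ∈ T` the quotient `(P̄^E_𝔩/P̄^E_𝔩̄)/(P̄^{E′}_𝔩/P̄^{E′}_𝔩̄) ∈ Ḡ`: with `z = (1+T)^{e_𝔩}`,
  `P̄_𝔩 = P̄(q̄⁻¹z)`, `P̄_𝔩̄ = P̄(q̄⁻¹z⁻¹)`; (i) `ℓ` multiplicative for one curve ⟹ (`E[3] ≅ E′[3]` unramified at `ℓ`)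
  the other's `P̄` splits with roots `{ā, āℓ̄} ⊂ F₃^×`, and roots in `F₃^×` give quotients `±z^k ∈ Ḡ`; (ii) `ℓ ≠ 3`
  additive for one curve ⟹ `E[3]` RAMIFIED at `ℓ` (`1 + 3M₂(ℤ₃)` is torsion-free; a potentially-multiplicative twist
  character is non-trivial mod `3`) ⟹ the other curve is bad at `ℓ` too, both `P` of degree `≤ 1` with roots in
  `F₃` ⟹ case (i) or `P = 1`.  (The only non-gauge quotients, `(z²−āz−1)/(z²+āz−1)` at `ℓ ≡ −1 (3)` with
  irreducible `P̄`, need GOOD `ℓ`, and good `ℓ ∉ T`.)  CAVEAT recorded: with A's FROZEN Assembly exponents `3^{c_v}`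
  the gauge statement would be FALSE (`(z^u − 1)/(z − 1) ∉ Ḡ` for `u ≢ 1 (9)`) — hence J⁼ keeps `∃ e`.
Conclusion: `X̄·D̄₁ = Ȳ·D̄₂` in the domain `F̄₃⟦T⟧` with `D̄₂/D̄₁ ∈ Ḡ` and `ℒ̄(g_E)² = ℒ̄(g_E′)² ≠ 0` cancelled ⟹
`X̄ = w̄(1+T)^s·Ȳ` ⟹ J⁼ (lift `w̄`).  ∎ modulo the leaves.

## 3. GR — statement (§4), proof sketch, status ATTACKABLE (no literature input)

`U ∈ R₀⟦T⟧^×`, `U(u₀^m − 1) = r^m` for `m ∈ m₀ + Mℕ`.  (a) `y ↦ U(u₀^y − 1)` lies in the Tate algebra `ℂ₃⟨y⟩`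
(`|log u₀|ⁿ/|n!| → 0`); (b) `k ↦ ρ^k` (`ρ = r^M`, `|ρ| = 1`) extends analytically to `ℤ₃` only if
`|ρ − 1| < 3^{-1/2}` (Amice: the Mahler coefficients of `(1+η)^k` are `ηⁿ`, analytic iff `|ηⁿ/n!| → 0`); (c)
re-expand at `a = u₀^{m₀} − 1`: `V(T′) := U(a + u₀^{m₀}T′) ∈ R₀⟦T′⟧^×` agrees with `r^{m₀}(1+T′)^s`,
`s = log ρ/(M log u₀)`, at the infinitely many points `u₀^{y′} − 1`, `y′ ∈ Mℤ₃`, inside the common convergence disc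
(`|sT′| ≤ |log ρ| < 3^{-1/2}`) ⟹ equal as series (Strassmann; tree: `UnrSeriesValueRigidity`, `BDPFrameUniqueness`);
(d) `V ∈ R₀⟦T′⟧` bounds `binom(s, n)`, and `|binom(s, 3^k)| ≥ 3^k·dist(s, ℤ₃)` forces `s ∈ ℤ₃`; (e) undo the shift:
`U = (r^{m₀}u₀^{-sm₀})·(1+T)^s`.  Lean size M–L (p-adic `exp`/`log` on `1 + 3ℤ₃`, Strassmann on a closed sub-disc).

## 4. Why J⁼ is the right strengthening — and the instrument it unlocks

* CONTENT beyond A: the digits `b₁, b₂, …` of `X̄Ȳ⁻¹/lead` must be `binom(s,1), binom(s,2), …` for ONE `s ∈ ℤ₃`; at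
  order two already `b₂ = s(s−1)/2` is determined by `b₁ = s mod 3` up to the next digit of `s` — a consistency check
  any two computed digits can fail.  KILLABLE per pair.
* INSTRUMENT «WEIGHT-JET CENSUS» (design; kit 0 in this seat; REQUESTS filed): for a twin pair and a target `K`,
  compute the CENTRAL values `L(f/K, φ_m, 1)`, `φ_m` unramified of infinity type `(m, −m)·` (interpolation range),
  `m ≤ 3K + 3`, algebraic parts to `3`-adic precision ≈ `2.5K` digits (classical: Waldspurger CM sums of
  `δ^{m−1}f` over `h_K` points, or Rankin–Selberg with weight-`2m+1` theta series — valid at `27 ∣ N`, no `3`-adic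
  modular forms needed; the row `m = 0` is the BDP / Heegner-log value of heegner-log-anchor); form the finite
  differences `α_j` (Kummer: `α_j ∈ (u₀ − 1)^j R₀`, `alternating_moment_symm`), convert to the weight-Taylor jet
  `τ_n` at `y = 0` (`τ_n = Σ_j α_j s(j,n)/j!`, convergent since `‖α_j/j!‖ ≤ 3^{-j/2}`), and solve the TRIANGULAR
  integer system `n!τ_n/(log u₀)^n = Σ_{k≤n} k! S(n,k) c_k` for `c₀..c_K mod 3` of `X` and of `Y` (the `k!` on the
  diagonal costs `v₃(k!)` guard digits): output `λ(X), λ(Y)` (decides A for the pair up to `K`) AND the digits of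
  `X̄/Ȳ` (tests J⁼).  Budget: `M ≈ 3K + 3` values, precision `≈ K + v₃(K!) + K/2 + 2` digits.  First target: the
  `K = 2` row (no factorial loss yet) on the smallest ClassO6 twin pair of the g2 census.
* Relation to sqrt-toric-functional (REGISTERED line; nearest): same nature-leaf (CM `t`-expansion measures,
  Waldspurger shape, Hsieh `μ = 0` on the twin).  Delta: that line POSITS an additive `Θ : (ℕ → ℤ) →+ R₀⟦T⟧` (its own
  card prices `C⁺⁺ ≈ A ∧ λ even`, near-costume); here `Θ := F ↦ c·ℒ(F)²` is quadratic, nothing is posited, and the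
  OUTPUT is sharpened from "equal `λ`" to the gauge statement J⁼ by two new elementary lemmas GR, EF.  Recommended to
  the line's lead: adopt J⁼ as the line's `C⁺` and GR, EF as its next stubs.

## 5. KEEP / KILL (gen 7; no instrument / vet output on 27120 since g4 — REQUESTS g2–g6 unanswered; g6 verdicts stand
unless noted)

* sqrt-toric-functional (REGISTERED) — KEEP, nearest road; g7 delta above.
* one-deep-layer (C^ρ, EQUIV mod hB) / gauss-extraction (C^□) — KEEP·UNDECIDED; g7: their E-side input HL1_E
  (ramified deep-conductor Waldspurger with stable `ε`) is strictly harder than KJ_E (unramified range, constant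
  local factor), and J⁼ ⟹ A ⟹ C^□ ⟹ C^ρ (g5, mod hB) — weight-jet dominates on the E-side input.
* heegner-log-anchor — KEEP (λ-blind anchor) = row `k = 0` of the weight-jet census.
* universal-period-pair / lambda-scale-blind — KEEP (structural); GR is the precise form of "period constants move
  frames only inside `G`".
* deep-conductor-stability — KEEP (horizontal, independent).
* eisenstein-degree-shadow (g6 bypass, UNDECIDED·WEAKER) — KEEP·bypass; g7 PRICING of `E_rat` (g6 ask): SOED walls
  W1 (`π₃` unramified principal series for any Eisenstein-family engine) and W3 (`U₃` nilpotent) are wild-side only,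
  but W2 (`N⁻ = 1`: no definite unitary carrier under strict Heegner [BCK21 p.4]) hits the TWIN as well — so `E_rat`
  cannot come from a `U(3,1)` engine either; it needs Howard + BCK-type Kolyvagin arguments, i.e. Kolyvagin
  primitivity at `p = 3` = barrier `NoAdmissiblePrimesAtThree` class-wide; per-pair certificate only.  No upgrade.
* rankin-selberg-linearity-transplant — DEAD (g6); g7 sharpening: the `27`-new vector has trace ZERO to tame
  `3`-level, forcing the full-level `𝓔_{1/N|d_K|}` with LMX's level factor [arXiv:2302.06553 Thm 4.6] and a
  circular refined integrality; weight-jet EVALUATES at CM points (no pairing, no trace).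
* Route dead lines 24208 kernel_rat RK-6 v2 / 24209 / RK-7 v1 — untouched (J⁼ lives inside 27120's signature).
* Disproof used: none relevant — no `Disproof.lean` / `Negative/` exists for this crux (`ledger crux ls`,
  2026-08-30); `ledger negatives --problem BirchSwinnertonDyer` has no Σ-congruence entry.  J⁼ consumes A's
  hypotheses honestly: `hmod` via JC, `hH/hH′` via the Heegner points, `hi′` + MU′ for the cancellation, `hT/hc` via
  EF's exponents, `hO6`/`haddv` fix which side is wild.

## 6. Dead ends recorded this generation (one line each; details in the memo)

* Hida / Coleman families through `f_E`: none (`U₃f_E = 0`, potentially supersingular; affinoid radius `> 3^{-1/2}`).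
* Principal-series-cell twist `f_E ⊗ ϑ̄` (`cond 9`, order `6`): the twist swaps wild/tame between `E` and `E′`.
* Langlands–Tunnell weight-one lift of `E[3]`: only more tame twins.
* Gauge statement at FROZEN exponents `3^{c_v}`: false shape (`(z^u−1)/(z−1) ∉ Ḡ`) — J⁼ keeps `∃ e`.
* Constant-only gauge (`s = 0`): FALSE over A's binders (`Ω_p ↦ tΩ_p` twists frames by `(1+T)^s`).
* "sup-norm on `|T| ≤ 1/3` reads `λ`": FALSE (`Φ = 3 + T²`); values are `λ`-blind pointwise, the JET is not.
* mod-`3` Kolyvagin-system rigidity at additive `3`: unprinted explicit reciprocity; positions encode `λ` anyway.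
* Raw value congruences at deep RAMIFIED CM characters: Gauss sums `‖𝔤(χ)‖ = 3^{-n/2}` make "mod 3" vacuous.

References.  [GreenbergVatsal2000] Thm (1.4), (1.5); [BDP13] Bertolini–Darmon–Prasanna, Duke 162 (2013) §5.2,
Thm 4.6, Thm 5.13; [CH18] Castella–Hsieh, Math. Ann. 370 (2018) §3.3, Thm 4.9; [KrizLi2019] FMS 7, Thm 1.16, §3;
[Kriz2016] ANT 10 (2016) Main Thm [corpus:paper-arxiv-1512.05032 p.8]; [Hsieh2014] Doc. Math. 19, Thm B; [CST14]
Cai–Shu–Tian, ANT 8 (2014) Prop 3.12; [Katz1976/78], [Gouvea1988] LNM 1304 III.6 (twisting); Kriz 2021 monograph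
[corpus:book:kriz2021-supersingular-p-adic-l-functions-maass-shimura p.103 (Katz Thm 4.4.1), p.147 (Thm 5.41,
`θ_AS = T d/dT`)]; [LMX2023] arXiv:2302.06553 §4; [BCK21] Burungale–Castella–Kim p.4; Amice (1964), Mahler
expansions / analyticity criterion; Washington GTM 83 §7.1 (Kummer congruences).
-/

set_option autoImplicit false
-- `…Cruxes.SigmaCongruenceAtThree…` workfile namespace (crux-chain convention).
set_option linter.dupNamespace false

noncomputable section

open scoped Classical

namespace Summit.BirchSwinnertonDyer.BirchSwinnertonDyer.Cruxes.SigmaCongruenceAtThree.WeightJetBinomial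

open NumberField IsDedekindDomain
open Literature.NumberTheory.EllipticCurves Literature.NumberTheory.EllipticCurves.GreenbergVatsal2000
  Summit.BirchSwinnertonDyer.Rank1Residual.X11b
  Summit.BirchSwinnertonDyer.BirchSwinnertonDyer.Theorems
  Summit.BirchSwinnertonDyer.BirchSwinnertonDyer.Theorems.UniversalToricDescentAcDualMuZero
  Summit.BirchSwinnertonDyer.BirchSwinnertonDyer.Theorems.UniversalToricDescentSigmaCongruenceInvariantPair
  Summit.BirchSwinnertonDyer.BirchSwinnertonDyer.Theorems.UniversalToricDescentDefectTransportModThreePTOfSigmaCongruence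
  Summit.BirchSwinnertonDyer.BirchSwinnertonDyer.Theses.UniversalToricDescent

/-! ## §1 The gauge group `G = R₀^× · (1+T)^{ℤ_p} ⊂ R₀⟦T⟧^×` (generic prime `p`; PROVED) -/

section Gauge

variable {p : ℕ} [hp : Fact p.Prime]

/-- **The gauge element `w·(1+T)^s ∈ R₀⟦T⟧`** (`w ∈ R₀`, `s ∈ ℤ_p`): the period-rescaling ambiguity of a BDP frame
(`Ω_p ↦ t·Ω_p` multiplies the `m`-th interpolation value by `t^{4m} = (1+T_m)^s`, `T_m = u₀^m − 1`). [folklore] -/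
def gauge (w : unrIntegers p) (s : ℤ_[p]) : UnrSeries p :=
  PowerSeries.C w * PowerSeries.map (Halves.toUnr p) (PowerSeries.binomialSeries ℤ_[p] s)

/-- `[T⁰](w(1+T)^s) = w`. [folklore] -/
theorem constantCoeff_gauge (w : unrIntegers p) (s : ℤ_[p]) : PowerSeries.constantCoeff (gauge w s) = w := by
  unfold gauge
  rw [map_mul, PowerSeries.constantCoeff_C, ← PowerSeries.coeff_zero_eq_constantCoeff_apply,
    PowerSeries.coeff_map, PowerSeries.coeff_zero_eq_constantCoeff_apply, PowerSeries.binomialSeries_constantCoeff,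
    map_one, mul_one]

/-- `[T¹](w(1+T)^s) = w·s`. [folklore] -/
theorem coeff_one_gauge (w : unrIntegers p) (s : ℤ_[p]) :
    PowerSeries.coeff 1 (gauge w s) = w * Halves.toUnr p s := by
  unfold gauge
  rw [PowerSeries.coeff_C_mul, PowerSeries.coeff_map, PowerSeries.binomialSeries_coeff, Ring.choose_one_right,
    smul_eq_mul, mul_one]

/-- **A gauge element with unit constant is a unit of `R₀⟦T⟧`** (so the gauge conclusion feeds A's `∃ u, IsUnit u`).
[folklore] -/
theorem isUnit_gauge {w : unrIntegers p} (hw : ‖(w : ℂ_[p])‖ = 1) (s : ℤ_[p]) : IsUnit (gauge w s) := by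
  rw [PowerSeries.isUnit_iff_constantCoeff, constantCoeff_gauge]
  exact (unrIntegers.isUnit_iff_norm_eq_one w).mpr hw

/-- `G` is closed under multiplication: `w(1+T)^s · w′(1+T)^{s′} = ww′(1+T)^{s+s′}`. [folklore] -/
theorem gauge_mul_gauge (w w' : unrIntegers p) (s s' : ℤ_[p]) :
    gauge w s * gauge w' s' = gauge (w * w') (s + s') := by
  unfold gauge
  rw [PowerSeries.binomialSeries_add, map_mul, map_mul]
  ring

/-- `1 ∈ G`. [folklore] -/
theorem gauge_one_zero : gauge (1 : unrIntegers p) 0 = 1 := by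
  unfold gauge
  rw [PowerSeries.binomialSeries_zero, map_one, map_one, one_mul]

/-- `G` is closed under inverses: `(w(1+T)^s)·(w⁻¹(1+T)^{−s}) = 1` for `‖w‖ = 1`. [folklore] -/
theorem gauge_mul_gauge_inv {w : unrIntegers p} (hw : ‖(w : ℂ_[p])‖ = 1) (s : ℤ_[p]) :
    gauge w s * gauge (((unrIntegers.isUnit_iff_norm_eq_one w).mpr hw).unit⁻¹ : (unrIntegers p)ˣ) (-s) = 1 := by
  rw [gauge_mul_gauge, IsUnit.mul_val_inv, add_neg_cancel, gauge_one_zero]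

end Gauge

/-! ## §2 Pair properties at `p = 3`: A's `UnitClass` versus the node's `GaugeClass` (STRICTLY stronger; PROVED) -/

section AtThree

/-- **A's pair property**: `X ≡ u·Y (mod 𝔪_{R₀})` coefficientwise for SOME unit `u ∈ R₀⟦T⟧^×`. [folklore] -/
def UnitClass (X Y : UnrSeries 3) : Prop :=
  ∃ u : UnrSeries 3, IsUnit u ∧ ∀ i : ℕ, ‖((PowerSeries.coeff i (X - u * Y) : unrIntegers 3) : ℂ_[3])‖ < 1

/-- **The node's pair property**: `X ≡ w(1+T)^s·Y (mod 𝔪_{R₀})` for a unit CONSTANT `w ∈ R₀^×` and `s ∈ ℤ₃` — the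
congruence holds up to the 2-parameter PERIOD GAUGE only. [folklore] -/
def GaugeClass (X Y : UnrSeries 3) : Prop :=
  ∃ (w : unrIntegers 3) (s : ℤ_[3]), ‖(w : ℂ_[3])‖ = 1 ∧
    ∀ i : ℕ, ‖((PowerSeries.coeff i (X - gauge w s * Y) : unrIntegers 3) : ℂ_[3])‖ < 1

/-- `GaugeClass ⟹ UnitClass` (the gauge element is a unit). [folklore] -/
theorem unitClass_of_gaugeClass {X Y : UnrSeries 3} (h : GaugeClass X Y) : UnitClass X Y := by
  obtain ⟨w, s, hw, hc⟩ := h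
  exact ⟨gauge w s, isUnit_gauge hw s, hc⟩

/-- `1 + s²` is a `3`-adic unit for every `s ∈ ℤ₃` (`−1` is not a square mod `3`). [folklore] -/
theorem norm_one_add_sq_eq_one (s : ℤ_[3]) : ‖(1 : ℤ_[3]) + s ^ 2‖ = 1 := by
  by_contra h
  have hlt : ‖(1 : ℤ_[3]) + s ^ 2‖ < 1 := lt_of_le_of_ne (PadicInt.norm_le_one _) h
  rw [PadicInt.norm_lt_one_iff_dvd] at hlt
  have hmem : (1 : ℤ_[3]) + s ^ 2 ∈ RingHom.ker (PadicInt.toZMod : ℤ_[3] →+* ZMod 3) := by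
    rw [PadicInt.ker_toZMod, PadicInt.maximalIdeal_eq_span_p, Ideal.mem_span_singleton]
    exact_mod_cast hlt
  rw [RingHom.mem_ker, map_add, map_one, map_pow] at hmem
  have hall : ∀ t : ZMod 3, (1 : ZMod 3) + t ^ 2 ≠ 0 := by decide
  exact hall _ hmem

/-- **STRICTNESS: `UnitClass` does NOT imply `GaugeClass`.**  Witness `X = 1 + √−1·T`, `Y = 1` (`√−1 ∈ R₀` at
`p = 3`): `X` is itself a unit, but `X ≡ w(1+T)^s` would force `√−1 ≡ s (mod 𝔪)` with `s ∈ ℤ₃`, i.e. `3 ∣ 1 + s²`.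
So the node's piece is NOT a costume of A's conclusion shape. [folklore] -/
theorem exists_unitClass_not_gaugeClass : ∃ X Y : UnrSeries 3, UnitClass X Y ∧ ¬ GaugeClass X Y := by
  obtain ⟨a, ha, ha2⟩ := exists_sq_eq_neg_one_mem_unrIntegers_three
  set α : unrIntegers 3 := ⟨a, ha⟩ with hα
  refine ⟨1 + PowerSeries.C α * PowerSeries.X, 1, ?_, ?_⟩
  · refine ⟨1 + PowerSeries.C α * PowerSeries.X, ?_, fun i ↦ ?_⟩
    · rw [PowerSeries.isUnit_iff_constantCoeff, map_add, map_one, map_mul, PowerSeries.constantCoeff_X, mul_zero,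
        add_zero]
      exact isUnit_one
    · rw [mul_one, sub_self, map_zero, ZeroMemClass.coe_zero, norm_zero]
      exact zero_lt_one
  · rintro ⟨w, s, hw, hc⟩
    have h0 := hc 0
    have h1 := hc 1
    rw [mul_one, map_sub, map_add, PowerSeries.coeff_zero_eq_constantCoeff_apply,
      PowerSeries.coeff_zero_eq_constantCoeff_apply, PowerSeries.coeff_zero_eq_constantCoeff_apply, map_one, map_mul,
      PowerSeries.constantCoeff_X, mul_zero, add_zero, constantCoeff_gauge] at h0
    rw [mul_one, map_sub, map_add, PowerSeries.coeff_one, if_neg one_ne_zero, zero_add, PowerSeries.coeff_C_mul,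
      PowerSeries.coeff_one_X, mul_one, coeff_one_gauge] at h1
    -- in `ℂ₃`: `‖1 − w‖ < 1`, `‖a − w·s‖ < 1`
    have h0' : ‖(1 : ℂ_[3]) - (w : ℂ_[3])‖ < 1 := by simpa using h0
    have h1' : ‖a - (w : ℂ_[3]) * ((Halves.toUnr 3 s : unrIntegers 3) : ℂ_[3])‖ < 1 := by simpa [hα] using h1
    set σ : ℂ_[3] := ((Halves.toUnr 3 s : unrIntegers 3) : ℂ_[3]) with hσ
    have hσ1 : ‖σ‖ ≤ 1 := Halves.norm_coe_unrIntegers_le_one 3 _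
    have hws : ‖(w : ℂ_[3]) * σ - σ‖ < 1 := by
      have : (w : ℂ_[3]) * σ - σ = -((1 - (w : ℂ_[3])) * σ) := by ring
      rw [this, norm_neg, norm_mul]
      calc ‖(1 : ℂ_[3]) - (w : ℂ_[3])‖ * ‖σ‖ ≤ ‖(1 : ℂ_[3]) - (w : ℂ_[3])‖ * 1 :=
            mul_le_mul_of_nonneg_left hσ1 (norm_nonneg _)
        _ < 1 := by rw [mul_one]; exact h0'
    have has : ‖a - σ‖ < 1 := by
      have : a - σ = (a - (w : ℂ_[3]) * σ) + ((w : ℂ_[3]) * σ - σ) := by ring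
      rw [this]
      exact lt_of_le_of_lt (IsUltrametricDist.norm_add_le_max _ _) (max_lt h1' hws)
    have hsq : ‖(1 : ℂ_[3]) + σ ^ 2‖ < 1 := by
      have : (1 : ℂ_[3]) + σ ^ 2 = -((a - σ) * (a + σ)) := by linear_combination ha2
      rw [this, norm_neg, norm_mul]
      have haσ : ‖a + σ‖ ≤ 1 := by
        refine (IsUltrametricDist.norm_add_le_max _ _).trans (max_le ?_ hσ1)
        exact Halves.norm_coe_unrIntegers_le_one 3 α
      calc ‖a - σ‖ * ‖a + σ‖ ≤ ‖a - σ‖ * 1 := mul_le_mul_of_nonneg_left haσ (norm_nonneg _)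
        _ < 1 := by rw [mul_one]; exact has
    have hnorm : ‖(1 : ℂ_[3]) + σ ^ 2‖ = 1 := by
      have : (1 : ℂ_[3]) + σ ^ 2 = ((Halves.toUnr 3 (1 + s ^ 2) : unrIntegers 3) : ℂ_[3]) := by
        rw [hσ, map_add, map_one, map_pow]
        push_cast
        ring
      rw [this, norm_coe_toUnr, norm_one_add_sq_eq_one]
    exact absurd hnorm (ne_of_lt hsq)

end AtThree

/-! ## §3 The typed piece J⁼ `GaugeCongruenceAtThree` and its compositions to A and to the PARENT, BY NAME -/

/-- **J⁼ `GaugeCongruenceAtThree` (crux-side piece; tag STRONGER than A, UNDECIDED).**  A's binders VERBATIM; A's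
conclusion with the unit `u ∈ R₀⟦T⟧^×` RESTRICTED to the period gauge `G = {w(1+T)^s : w ∈ R₀^×, s ∈ ℤ₃}`:
`∃ e (v₃(e_v) = c_v) ∃ w s, 𝓛·∏_{v∈T}P_v(q_v⁻¹(1+T)^{e_v}) ≡ w(1+T)^s · 𝓛′·∏_{v∈T}P′_v(q_v⁻¹(1+T)^{e_v}) (mod 𝔪_{R₀})`
coefficientwise.  What the Katz road delivers (module docstring §2): frames are unique up to `G` (GR), the
square-root CM series of the two `T3`-depleted forms are congruent mod `3` as SERIES (JC), and at the TRUE Frobenius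
exponents the Euler quotients of the `3`-congruent pair lie in `G` mod `𝔪` (EF). [cite: GreenbergVatsal2000, Thm. (1.5)]
[cite: BDP2013, Thm. 5.13] [cite: KrizLi2019, Thm. 1.16] -/
def GaugeCongruenceAtThree : Prop :=
    ∀ (W : WeierstrassCurve ℚ) [W.IsElliptic] [W.IsGloballyMinimal] (W' : WeierstrassCurve ℚ) [W'.IsElliptic]
    [W'.IsGloballyMinimal] (N N' : ℕ) [NeZero N] [NeZero N'] (K : Type) [Field K] [NumberField K] (Dt :
    Literature.NumberTheory.EllipticCurves.ModularForms.ModularParametrizationData W N) (Dt' :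
    Literature.NumberTheory.EllipticCurves.ModularForms.ModularParametrizationData W' N'),
    Summit.BirchSwinnertonDyer.Rank1Residual.Additive.ClassO6 W 3 → W.HasSurjectiveModNGaloisRep 3 → W.analyticRank
    = 1 → W.conductorNorm ℤ = N → Summit.BirchSwinnertonDyer.Rank1Residual.O6.ModPCongruent W' W 3 → ¬
    Literature.NumberTheory.EllipticCurves.Rank1Residual.Addv W' 3 → W'.conductorNorm ℤ = N' →
    Literature.NumberTheory.EllipticCurves.IsImaginaryQuadratic K →
    Literature.NumberTheory.EllipticCurves.SatisfiesHeegnerHypothesis N K →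
    Literature.NumberTheory.EllipticCurves.SatisfiesHeegnerHypothesis N' K → ∀ (κ :
    Literature.NumberTheory.EllipticCurves.ZpExtension K 3), κ.IsAnticyclotomic → ∀ (γ : Field.absoluteGaloisGroup
    K) [Fact (κ.IsTopGenerator γ)] (𝔭 : IsDedekindDomain.HeightOneSpectrum (NumberField.RingOfIntegers K)), ((3 : ℕ)
    : NumberField.RingOfIntegers K) ∈ 𝔭.asIdeal → 𝔭.asIdeal.ramificationIdx (NumberField.RingOfIntegers ℚ) = 1 →
    𝔭.asIdeal.inertiaDeg (NumberField.RingOfIntegers ℚ) = 1 → ∀ (𝔭' : IsDedekindDomain.HeightOneSpectrum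
    (NumberField.RingOfIntegers K)), ((3 : ℕ) : NumberField.RingOfIntegers K) ∈ 𝔭'.asIdeal → 𝔭' ≠ 𝔭 → ∀ (ι' :
    PadicAlgCl 3 ≃+* ℂ), Summit.BirchSwinnertonDyer.BirchSwinnertonDyer.Theorems.SchneiderFree.BranchInducesPrime 3
    ι' 𝔭 → ∀ (ΩK : ℂ) (Ωp : ℂ_[3]) (L : Literature.NumberTheory.EllipticCurves.UnrSeries 3), ΩK ≠ 0 → Ωp ≠ 0 →
    Literature.NumberTheory.EllipticCurves.IsBDPLFunction ι' 𝔭 κ γ Dt.f ΩK Ωp L → ∀ (ΩK' : ℂ) (Ωp' : ℂ_[3]) (L' :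
    Literature.NumberTheory.EllipticCurves.UnrSeries 3), ΩK' ≠ 0 → Ωp' ≠ 0 →
    Literature.NumberTheory.EllipticCurves.IsBDPLFunction ι' 𝔭 κ γ Dt'.f ΩK' Ωp' L' → (∃ i : ℕ, ‖((PowerSeries.coeff
    i L' : Literature.NumberTheory.EllipticCurves.unrIntegers 3) : ℂ_[3])‖ = 1) → ∀ (T : Finset
    (IsDedekindDomain.HeightOneSpectrum (NumberField.RingOfIntegers K))) (c : IsDedekindDomain.HeightOneSpectrum
    (NumberField.RingOfIntegers K) → ℕ), (↑T = {v : IsDedekindDomain.HeightOneSpectrum (NumberField.RingOfIntegers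
    K) | ((3 : ℕ) : NumberField.RingOfIntegers K) ∉ v.asIdeal ∧ (¬ (W.baseChange K).HasGoodReductionAt v ∨ ¬
    (W'.baseChange K).HasGoodReductionAt v)}) → (∀ v ∈ T, (∃ d₀ :
    Literature.NumberTheory.EllipticCurves.GreenbergSelmer.decomp (K := K) v, (κ (d₀ : Field.absoluteGaloisGroup
    K)).toAdd = (3 : ℤ_[3]) ^ c v) ∧ (∀ d : Literature.NumberTheory.EllipticCurves.GreenbergSelmer.decomp (K := K)
    v, (3 : ℤ_[3]) ^ c v ∣ (κ (d : Field.absoluteGaloisGroup K)).toAdd)) → ∃ (e : IsDedekindDomain.HeightOneSpectrum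
    (NumberField.RingOfIntegers K) → ℤ_[3]) (w : Literature.NumberTheory.EllipticCurves.unrIntegers 3) (s : ℤ_[3]),
    ‖(w : ℂ_[3])‖ = 1 ∧ (∀ v ∈ T, e v ≠ 0 ∧ (e v).valuation = c v) ∧ ∀ i : ℕ, ‖((PowerSeries.coeff i (L *
    PowerSeries.map (Summit.BirchSwinnertonDyer.Rank1Residual.X11b.Halves.toUnr 3) (∏ v ∈ T, (Polynomial.aeval
    (PowerSeries.C ((Nat.card (IsLocalRing.ResidueField (v.adicCompletionIntegers K)) : ℤ_[3]).inv) *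
    PowerSeries.binomialSeries ℤ_[3] (e v)) ((W.baseChange K).localPolynomialAt v) :
    Literature.NumberTheory.EllipticCurves.IwasawaAlgebra 3)) - gauge w s * (L' * PowerSeries.map
    (Summit.BirchSwinnertonDyer.Rank1Residual.X11b.Halves.toUnr 3) (∏ v ∈ T, (Polynomial.aeval (PowerSeries.C
    ((Nat.card (IsLocalRing.ResidueField (v.adicCompletionIntegers K)) : ℤ_[3]).inv) * PowerSeries.binomialSeries
    ℤ_[3] (e v)) ((W'.baseChange K).localPolynomialAt v) : Literature.NumberTheory.EllipticCurves.IwasawaAlgebra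
    3)))) : Literature.NumberTheory.EllipticCurves.unrIntegers 3) : ℂ_[3])‖ < 1

/-- **J⁼ ⟹ A `SigmaCongruenceAtThree` BY NAME** (no `hB`, no print input: the gauge element is a unit).
[cite: GreenbergVatsal2000, Thm. (1.5)] -/
theorem sigmaCongruenceAtThree_of_gaugeCongruence (h : GaugeCongruenceAtThree) : SigmaCongruenceAtThree := by
  haveI : Fact (Nat.Prime 3) := ⟨Nat.prime_three⟩
  unfold GaugeCongruenceAtThree at h
  unfold SigmaCongruenceAtThree
  intro W _ _ W' _ _ N N' _ _ K _ _ Dt Dt' hO6 hsurj hrk hN hmod haddv hN' hK hH hH' κ hκ γ _ 𝔭 h𝔭 hram hdeg 𝔭'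
    h𝔭' hne ι' hι ΩK Ωp L hΩK hΩp hL ΩK' Ωp' L' hΩK' hΩp' hL' hi' T c hT hc
  obtain ⟨e, w, s, hw, he, hcong⟩ := h W W' N N' K Dt Dt' hO6 hsurj hrk hN hmod haddv hN' hK hH hH' κ hκ γ 𝔭 h𝔭
    hram hdeg 𝔭' h𝔭' hne ι' hι ΩK Ωp L hΩK hΩp hL ΩK' Ωp' L' hΩK' hΩp' hL' hi' T c hT hc
  exact ⟨e, gauge w s, isUnit_gauge hw s, he, hcong⟩

/-- **J⁼ ⟹ the PARENT ♭T≤ `DefectTransportModThreePT` BY NAME**, via B″ (p698423,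
`defectTransportModThreePT_of_sigmaCongruenceAtThree`). [cite: GreenbergVatsal2000, Thm. (1.4) and (1.5)] -/
theorem defectTransportModThreePT_of_gaugeCongruence (h : GaugeCongruenceAtThree) : DefectTransportModThreePT :=
  defectTransportModThreePT_of_sigmaCongruenceAtThree (sigmaCongruenceAtThree_of_gaugeCongruence h)

/-! ## §4 Typed ATTACKABLE leaf GR: gauge rigidity of interpolating units (3-adic analysis; UNDECIDED here) -/

/-- **GR `GaugeRigidityAtThree` (support leaf; tag WEAKER than A — a pure `3`-adic analysis lemma, ATTACKABLE).**
A unit `U ∈ R₀⟦T⟧^×` whose values along an arithmetic progression of interpolation points `T_m = u₀^m − 1`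
(`u₀ ∈ 1 + 3ℤ₃`, `u₀ ≠ 1`, `m ∈ m₀ + Mℕ`, `M ≥ 1`) form a GEOMETRIC sequence `r^m` IS a gauge element `w(1+T)^s`.
(Proof sketch, §3 of the module docstring: `y ↦ U(u₀^y − 1)` is rigid-analytic on `ℤ₃`; a geometric sequence that
extends analytically has ratio in `1 + 𝔪` with `|ρ − 1| < 3^{-1/2}`; identity principle on the disc
`|T′| ≤ |M|/3`, then boundedness of `binom(s, n)` forces `s ∈ ℤ₃`.)  It is what makes J⁼ (rather than only A) the
output of the Katz road: two BDP frames of one form differ by an interpolating unit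
(tree: `UniversalToricDescentTwinSplit.span_singleton_eq_of_isBDPLFunction`), hence by a gauge element. [folklore] -/
def GaugeRigidityAtThree : Prop :=
  ∀ (U : UnrSeries 3), IsUnit U → ∀ (u₀ : ℤ_[3]), ‖u₀ - 1‖ < 1 → u₀ ≠ 1 → ∀ (r : ℂ_[3]) (m₀ M : ℕ), 0 < M →
    (∀ k : ℕ, U.HasValueAt (((Halves.toUnr 3 (u₀ ^ (m₀ + M * k) - 1) : unrIntegers 3) : ℂ_[3]))
      (r ^ (m₀ + M * k))) →
    ∃ (w : unrIntegers 3) (s : ℤ_[3]), ‖(w : ℂ_[3])‖ = 1 ∧ U = gauge w s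

/-! ## §5 The weight-jet ↔ interpolation-value dictionary (Mahler finite differences; PROVED, generic ring) -/

section Mahler

open Finset

/-- **Symmetry of the mixed moment** `Δ^m[(u^y − 1)^k](0) = Σ_{i≤m} (−1)^{m−i} C(m,i) (u^i − 1)^k
 = Σ_{j≤k} (−1)^{k−j} C(k,j) (u^j − 1)^m` in any commutative ring: both sides equal
`Σ_{i,j} (−1)^{m−i+k−j} C(m,i) C(k,j) u^{ij}`.  Read with `‖u^j − 1‖ ≤ ‖u − 1‖`, it gives the Kummer-type bound
`‖α_m‖ ≤ ‖u₀ − 1‖^m` for the Mahler coefficients `α_m = Σ_k c_k Δ^m[(u₀^y−1)^k](0)` of `m ↦ X(u₀^m − 1)` — the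
bound that makes the Mahler → weight-Taylor change of basis converge, by which the weight-jet `(c_k mod 3)_{k ≤ K}`
— hence `λ ≤ K` — is decided from the first `O(K)` interpolation VALUES `X(u₀^m − 1)` (central values
`L(f_E/K, φ_m, 1)`) known to `3`-adic precision `O(K log K)` (instrument «weight-jet census», module docstring §4).
[folklore] -/
theorem alternating_moment_symm {R : Type*} [CommRing R] (u : R) (m k : ℕ) :
    ∑ i ∈ range (m + 1), (-1 : R) ^ (m - i) * (m.choose i : R) * (u ^ i - 1) ^ k =
      ∑ j ∈ range (k + 1), (-1 : R) ^ (k - j) * (k.choose j : R) * (u ^ j - 1) ^ m := by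
  have key : ∀ (a b : ℕ), ∑ i ∈ range (a + 1), (-1 : R) ^ (a - i) * (a.choose i : R) * (u ^ i - 1) ^ b =
      ∑ i ∈ range (a + 1), ∑ j ∈ range (b + 1),
        (-1 : R) ^ (a - i) * (a.choose i : R) * ((-1 : R) ^ (b - j) * (b.choose j : R) * u ^ (i * j)) := by
    intro a b
    refine sum_congr rfl fun i _ ↦ ?_
    have hexp : (u ^ i - 1) ^ b = ∑ j ∈ range (b + 1), (-1 : R) ^ (b - j) * (b.choose j : R) * u ^ (i * j) := by
      have h := (Commute.all (u ^ i) (-1 : R)).add_pow b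
      rw [← sub_eq_add_neg] at h
      rw [h]
      refine sum_congr rfl fun j hj ↦ ?_
      rw [pow_mul]
      ring
    rw [hexp, mul_sum]
  rw [key m k, key k m, sum_comm]
  refine sum_congr rfl fun j _ ↦ sum_congr rfl fun i _ ↦ ?_
  rw [mul_comm i j]
  ring

end Mahler

end Summit.BirchSwinnertonDyer.BirchSwinnertonDyer.Cruxes.SigmaCongruenceAtThree.WeightJetBinomial

end
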